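import Literature.MathematicalPhysics.QuantumFieldTheory.Balaban1983to89.Beta.BalabanCompositeJets
import Literature.MathematicalPhysics.QuantumFieldTheory.Balaban1983to89.Beta.AveragingHessianKernelsRooted

/-!
# The ROOTED first-order spine of Bałaban's step jets — part A: the `j = 0` stencil `S0At ρ` and its datum `jsBal0AtOf`

HONEST FRAMING (cell charter, verbatim): «discharging BetaPertH makes Balaban's UV stability UNCONDITIONAL — a real
constructive-QFT result; it is NOT the continuum limit and NOT the Clay problem.»  DERIVED cell leaf (pub-balaban β sub-cell,
lane an2, work-order (P7′) stage ρ2 of the β lead: WALL v2.21 «the first-order spine (`vhS`/`hessFF` in `S0`/`Sc`/`Sstep`/`Spure`)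
and `dress` stay corner-rooted until an2's ρ1 (`dressAt ρ`) and ρ2 (`S0At/…/JsBalT2At` at `ctr`, `Odd Lc`) land ⇒ v2.22 = the
COHERENT CENTRED literal»); no statement of Bałaban's papers is typed here, no `[cite:]` tag, no `Prop` fact; it instantiates no
binder of the β-function wall by itself.  NOT `BetaPertH`; NOT continuum; NOT Clay.

## What is here (decl-by-decl twin of `BalabanStepJets` §3–§4 with an1's ROOTED tables)

`BalabanStepJets.S0` hard-wires an1's corner-rooted tables `vhS d Lc` / `hessFF Lc` (comb root = block base point).  an1's
`AveragingHessianKernelsRooted` re-typed both for an arbitrary root offset `ρ` (`vhSAt ρ d Lc`, `hessFFAt ρ Lc`; the same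
constants and byte shapes, `vhSAt_zero`/`hessFFAt_zero` the bridges).  This part threads `ρ` through the `j = 0` member:

* `S0At ρ cE cVH cΛ κ′ u := cE • wilsonA κ′ u + cVH • mfNeg (vhSAt ρ d Lc κ′ u) + cΛ • SLam Lc (lamCoeffOf (KInv Lc) Lc) (hessFFAt ρ Lc)`
  (the resolvent `KInv` is ROOT-FREE — straight contour sums, weak axial gauge enters only through the dressing);
* `locStencil_S0At (hLc) (hr : r ∈ box (d+1) Lc)`, `S0At_translate`, `S0At_antisymm` — the proofs of `BalabanStepJets` verbatim with
  an1's rooted lemmas `locStencil_vhSAt`/`vhSAt_translate`/`vhSAt_symm`/`biLoc_hessFFAt`/`hessFFAt_translate`/`hessFFAt_antisymm`;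
* `jsBal0AtOf hLc hr cE cVH cΛ W Cw δw hδw hW : JetData d Lc` (+ `_S`/`_W` by `rfl`);
* the bridge `S0At_zero : S0At 0 … = BalabanStepJets.S0 …`.

Parts B–E (`SpineRootedSc`, `SpineRootedStep`, `SpineRootedW2`, `SpineRootedT2`) thread `ρ` through the composite stencil, the step
members, the second-order family and the T₂-instantiation; the centred instance is `ρ = toSite (ctrOff (d+1) Lc)`, `Odd Lc`.

Provenance: b2b-balaban β sub-cell, unit beta-an2 gen 11, 2026-08-19 (v1); over `Beta.BalabanStepJets` (an2 lineage) and
`Beta.AveragingHessianKernelsRooted` (an1 lineage) BY NAME; no existing file touched.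
-/

open Finset
open scoped BigOperators
open Literature.MathematicalPhysics.QuantumFieldTheory
open Literature.MathematicalPhysics.QuantumFieldTheory.Balaban1983to89
open Literature.MathematicalPhysics.QuantumFieldTheory.Balaban1983to89.Beta
open LatticeForm (quo proj_add_zsmul)
open BlochFibreUniqueness (quo_add_zsmul)
open B12Sec2to5 (l1 l1_nonneg)
open ExpKernelCalculus (Decays BiLoc VertexFamily VertexFamily₂ shiftK Zl Zl_nonneg l1_sub_triangle l1_sub_symm)
open OneStepResolventKernel (Fib LocStencil JetData KInv decays_KInv shiftK_KInv biLoc_mono biLoc_finset_sum)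
open AffineAveraging (Form1 Form2 box toSite)
open StepJetData (wilsonA wBound locStencil_wilsonA wilsonA_translate wilsonA_antisymm mfNeg mfNeg_shiftK locStencil_mfNeg
  mfNeg_antisymm locStencil_add locStencil_smul biLoc_smul biLoc_weaken l1_add_le)
open AveragingHessianKernels (vhS hessFF ell)
open AveragingHessianKernelsRooted (vhSAt locStencil_vhSAt vhSAt_translate vhSAt_symm hessFFAt hessFFAt_antisymm biLoc_hessFFAt
  hessFFAt_translate vhSAt_zero hessFFAt_zero)
open InterLevelTransport (SLam locStencil_SLam SLam_translate cwsum avgLift biLoc_avgLift avgLift_shiftK)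
open BalabanStepJets (lamCoeffOf abs_lamCoeffOf_le lamCoeffOf_translate cwsum_antisymm locStencil_mono vertexFamily₂_mono S0)

noncomputable section

namespace Summit.QuantumFields.BalabanUV.Beta.SpineRooted

/-! ## §A1 The rooted `j = 0` stencil -/

section StepZero

variable (d : ℕ) (Lc : ℕ) [NeZero Lc]

/-- [folklore] **BAŁABAN'S `j = 0` FIRST-ORDER STENCIL FAMILY, COMB ROOT `Lc•blk + ρ`:**
`S0At ρ κ′ u := cE • wilsonA κ′ u + cVH • mfNeg (vhSAt ρ d Lc κ′ u) + cΛ • SLam Lc (lamCoeffOf (KInv Lc) Lc) (hessFFAt ρ Lc) κ′ u`. -/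
def S0At (ρ : Fin (d + 1) → ℤ) (cE cVH cΛ : ℝ) : Fin (d + 1) → (Fin (d + 1) → ℤ) → ExpKernelCalculus.MKer (d + 1) (Fib d) :=
  fun κ' u =>
    cE • wilsonA d κ' u + cVH • mfNeg (vhSAt ρ d Lc rfl κ' u) +
      cΛ • SLam Lc (lamCoeffOf (KInv (N := Lc) (d := d)) Lc) (fun μ y => hessFFAt ρ Lc μ y) κ' u

variable {d Lc}

/-- [folklore] **BRIDGE:** at the corner root `ρ = 0`, `S0At 0 = BalabanStepJets.S0`. -/
theorem S0At_zero (cE cVH cΛ : ℝ) : S0At d Lc 0 cE cVH cΛ = S0 d Lc cE cVH cΛ := by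
  funext κ' u
  simp only [S0At, S0, vhSAt_zero, hessFFAt_zero]

/-- [folklore] **`S0At ρ` IS A LOCAL STENCIL FAMILY** for in-block roots `ρ = toSite r` (proof of `locStencil_S0` with an1's rooted lemmas). -/
theorem locStencil_S0At (hLc : 1 ≤ Lc) {r : Fin (d + 1) → ℕ} (hr : r ∈ box (d + 1) Lc) (cE cVH cΛ : ℝ) :
    ∃ Cs δ : ℝ, 0 < δ ∧ LocStencil (S0At d Lc (toSite r) cE cVH cΛ) Cs δ := by
  obtain ⟨δ₀, C, hδ₀, hC, hdec⟩ := decays_KInv (N := Lc) (d := d)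
  have hδ2 : (0 : ℝ) ≤ δ₀ / 2 := by positivity
  have h1 : LocStencil (wilsonA d) (wBound d * Real.exp (4 * (δ₀ / 2))) (δ₀ / 2) := locStencil_wilsonA hδ2
  have h2 : LocStencil (fun κ' u => mfNeg (vhSAt (toSite r) d Lc rfl κ' u))
      (3 * (ell (d + 1) Lc : ℝ) ^ 2 * Real.exp (4 * ((d : ℝ) + 1) * Lc * (δ₀ / 2))) (δ₀ / 2) :=
    locStencil_mfNeg (locStencil_vhSAt hLc hr hδ2)
  have hc := abs_lamCoeffOf_le (N := Lc) hdec hC hδ₀.le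
  have hQ : VertexFamily (fun μ y => hessFFAt (toSite r) Lc μ y) Lc
      (2 * (ell (d + 1) Lc : ℝ) ^ 2 * Real.exp (4 * ((d : ℝ) + 1) * Lc * δ₀)) δ₀ :=
    fun μ y => biLoc_hessFFAt hLc μ y hr hδ₀.le
  have h3 := locStencil_SLam (N := Lc) hc hQ hδ₀ (mul_nonneg (mul_nonneg (by positivity) hC) (Real.exp_pos _).le)
  exact ⟨_, δ₀ / 2, by positivity,
    locStencil_add (locStencil_add (locStencil_smul cE h1) (locStencil_smul cVH h2)) (locStencil_smul cΛ h3)⟩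

/-- [folklore] **BLOCK-TRANSLATION COVARIANCE OF `S0At ρ`** (all roots): `S0At ρ κ′ (u + Lc•t) = shiftK (−Lc•t) (S0At ρ κ′ u)`. -/
theorem S0At_translate (ρ : Fin (d + 1) → ℤ) (hLc : 1 ≤ Lc) (cE cVH cΛ : ℝ) (κ' : Fin (d + 1)) (u t : Fin (d + 1) → ℤ) :
    S0At d Lc ρ cE cVH cΛ κ' (u + (Lc : ℤ) • t) = shiftK (-((Lc : ℤ) • t)) (S0At d Lc ρ cE cVH cΛ κ' u) := by
  have h1 := wilsonA_translate (d := d) κ' u ((Lc : ℤ) • t)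
  have h2 := vhSAt_translate (d := d) ρ hLc κ' u t
  have h3 := SLam_translate (N := Lc) (c := lamCoeffOf (KInv (N := Lc) (d := d)) Lc) (Q2 := fun μ y => hessFFAt ρ Lc μ y)
    (fun μ y κ'' u' t' => lamCoeffOf_translate (fun s => shiftK_KInv (N := Lc) (d := d) s) μ y κ'' u' t')
    (fun μ y t' => hessFFAt_translate ρ μ y t') κ' u t
  funext x z a b
  simp only [S0At, Pi.add_apply, Pi.smul_apply, smul_eq_mul, shiftK]
  rw [h1, h2, mfNeg_shiftK, h3]
  rfl

/-- [folklore] **`S0At ρ` IS ANTISYMMETRIC ON THE PACKED FIBRE** (all roots). -/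
theorem S0At_antisymm (ρ : Fin (d + 1) → ℤ) (cE cVH cΛ : ℝ) (κ' : Fin (d + 1)) (u x z : Fin (d + 1) → ℤ) (a b : Fib d) :
    S0At d Lc ρ cE cVH cΛ κ' u z x b a = -S0At d Lc ρ cE cVH cΛ κ' u x z a b := by
  have h1 := wilsonA_antisymm (d := d) κ' u x z a b
  have h2 := mfNeg_antisymm (K := vhSAt ρ d Lc rfl κ' u) (fun x z a b => vhSAt_symm ρ Lc κ' u x z a b) (fun _ _ _ _ => rfl)
    (fun _ _ _ _ => rfl) x z a b
  have h3 : SLam Lc (lamCoeffOf (KInv (N := Lc) (d := d)) Lc) (fun μ y => hessFFAt ρ Lc μ y) κ' u z x b a =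
      -SLam Lc (lamCoeffOf (KInv (N := Lc) (d := d)) Lc) (fun μ y => hessFFAt ρ Lc μ y) κ' u x z a b := by
    simp only [SLam, neg_neg]
    rw [← Finset.sum_neg_distrib]
    exact Finset.sum_congr rfl fun μ _ => by
      rw [cwsum_antisymm _ (fun y x z a b => hessFFAt_antisymm ρ Lc μ y x z a b) x z a b, neg_neg]
  simp only [S0At, Pi.add_apply, Pi.smul_apply, smul_eq_mul]
  rw [h1, h2, h3]
  ring

end StepZero

/-! ## §A2 Packaging: the rooted `j = 0` datum -/

section Packaging

variable {d : ℕ} {Lc : ℕ} [NeZero Lc]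

/-- [folklore] **THE ROOTED `j = 0` JET DATUM** `(S0At (toSite r), W)` for any admissible second-order family `W`. -/
def jsBal0AtOf (hLc : 1 ≤ Lc) {r : Fin (d + 1) → ℕ} (hr : r ∈ box (d + 1) Lc) (cE cVH cΛ : ℝ)
    (W : Fin (d + 1) → (Fin (d + 1) → ℤ) → Fin (d + 1) → (Fin (d + 1) → ℤ) → ExpKernelCalculus.MKer (d + 1) (Fib d))
    (Cw δw : ℝ) (hδw : 0 < δw) (hW : VertexFamily₂ W Lc Cw δw) : JetData d Lc :=
  have hS := locStencil_S0At (d := d) (Lc := Lc) hLc hr cE cVH cΛ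
  have hδS : 0 < hS.choose_spec.choose := hS.choose_spec.choose_spec.1
  have hloc : LocStencil (S0At d Lc (toSite r) cE cVH cΛ) hS.choose hS.choose_spec.choose := hS.choose_spec.choose_spec.2
  { S := S0At d Lc (toSite r) cE cVH cΛ
    W := W
    Cs := hS.choose
    Cw := Cw
    δ := min hS.choose_spec.choose δw
    δ_pos := lt_min hδS hδw
    loc := locStencil_mono hloc ((hloc 0 0).nonneg (Sum.inl 0)) (min_le_left _ _)
    loc₂ := vertexFamily₂_mono hW ((hW 0 0 0 0).nonneg (Sum.inl 0)) (min_le_right _ _) }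

/-- [folklore] The first-order part of the rooted datum is `S0At (toSite r)`. -/
@[simp] theorem jsBal0AtOf_S (hLc : 1 ≤ Lc) {r : Fin (d + 1) → ℕ} (hr : r ∈ box (d + 1) Lc) (cE cVH cΛ : ℝ)
    (W : Fin (d + 1) → (Fin (d + 1) → ℤ) → Fin (d + 1) → (Fin (d + 1) → ℤ) → ExpKernelCalculus.MKer (d + 1) (Fib d))
    (Cw δw : ℝ) (hδw : 0 < δw) (hW : VertexFamily₂ W Lc Cw δw) :
    (jsBal0AtOf hLc hr cE cVH cΛ W Cw δw hδw hW).S = S0At d Lc (toSite r) cE cVH cΛ := rfl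

/-- [folklore] The second-order part of the rooted datum is the given `W`. -/
@[simp] theorem jsBal0AtOf_W (hLc : 1 ≤ Lc) {r : Fin (d + 1) → ℕ} (hr : r ∈ box (d + 1) Lc) (cE cVH cΛ : ℝ)
    (W : Fin (d + 1) → (Fin (d + 1) → ℤ) → Fin (d + 1) → (Fin (d + 1) → ℤ) → ExpKernelCalculus.MKer (d + 1) (Fib d))
    (Cw δw : ℝ) (hδw : 0 < δw) (hW : VertexFamily₂ W Lc Cw δw) :
    (jsBal0AtOf hLc hr cE cVH cΛ W Cw δw hδw hW).W = W := rfl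

end Packaging

end Summit.QuantumFields.BalabanUV.Beta.SpineRooted

end
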